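import Summits.QuantumFields.YangMills.Theorems.FradkinShenkerFlowFiniteSusceptibilityWeakCouplingSpeciesParity
import Summits.QuantumFields.YangMills.Theorems.FradkinShenkerFlowFiniteSusceptibilityWeakCouplingAxisIsotropy
import Summits.QuantumFields.YangMills.Theorems.FradkinShenkerFlowFiniteSusceptibilityWeakCouplingAxisReflections
import Summits.QuantumFields.YangMills.Theorems.FradkinShenkerFlowFiniteSusceptibilityWeakCouplingSelectionRule
import Summits.QuantumFields.YangMills.Theorems.FradkinShenkerFlowFiniteSusceptibilityWeakCouplingPolarisation
import Summits.QuantumFields.YangMills.Theorems.FradkinShenkerFlowFiniteSusceptibilityWeakCouplingAxisOddSummable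
import HarnessLib

/-!
# Spatial parity of species: the purity half is its axis-even sector plus a direction transfer (item stmt-QuantumFields-9442)

Support file for item stmt-QuantumFields-9442 (route `FradkinShenkerFlow` of `YangMills`), crux
`Summit.QuantumFields.YangMills.Theses.FradkinShenkerFlow.FiniteSusceptibilityWeakCoupling`, line `purity-rate-split` (lead c21),
registered stub `stub_noEvenLRO_iff_axisParity`. The purity half of the crux (child item stmt-QuantumFields-18060
`NoEvenLongRangeOrder`: at weak coupling no time-reflection-EVEN gauge-invariant local observable has long-range order along the
time axis, uniformly in the odd tori) is cut along the three SPATIAL axis reflections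
`θ_k V := configPermZd (swap 0 k) (cfgReflect (configPermZd (swap 0 k) V))` (`k = 1, 2, 3`; `θ_0 = cfgReflect = Θ`):

* the torus Wilson state is `θ_k`-invariant and `θ_k` commutes with time translations, so a `θ_k`-even and a `θ_k`-odd observable
  have identically vanishing connected time correlation (selection rule, landed `stub_spatialReflectionSelectionRule`), whence the
  POLARISATION IDENTITY `4·c_A = c_{A + A∘θ_k} + c_{A − A∘θ_k}` for the time-axis autocorrelation of every species (§3);
* the four reflections commute (landed `stub_axisReflectionsCommute`), so even/odd parts inherit time-reflection evenness (§2);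
* iterating over `k = 1, 2, 3`: **`NoEvenLongRangeOrder ⟺ NoAxisEvenLRO ∧ EvenOddDirectionTransfer`** (§5–§6) — no long-range order
  along the time axis for species even under ALL FOUR axis reflections, and for species that are `Θ`-even but `θ_k`-ODD for some
  spatial `k` (whose autocorrelation along their own axis `e_k` is `β`-uniformly `ℓ¹` by the landed spatial lattice Vafa–Witten
  theorem `stub_axisOddSpeciesSummable`, so that the second conjunct is exactly "long-range order is direction-blind").

Every compact `G`, every real `β` for the identities; the cut itself is pure bookkeeping on top of them (crux-strategist gen-2 §D5).
Nothing here is a named fact. [folklore]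
-/

noncomputable section

open MeasureTheory ProbabilityTheory Finset
open Literature.MathematicalPhysics.QuantumFieldTheory hiding Site ZdEdge
open Literature.MathematicalPhysics.QuantumLattice
open Literature.Probability.LatticeModels hiding configShift configShift_apply

namespace Summit.QuantumFields.YangMills.Theorems.FiniteSusceptibilityWeakCoupling

namespace AxisParity

open MirrorDominationAxis0 SpeciesParity AxisIsotropy

variable {G : Type} [Group G] [MeasurableSpace G]

/-! ## §1 The axis reflections `θ_k` (conjugated form) -/

omit [Group G] in
/-- `configPermZd` of the identity permutation is the identity. [folklore] -/
theorem configPermZd_refl (V : LGConfig 4 G) : configPermZd (Equiv.refl (Fin 4)) V = V := by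
  funext e
  rw [configPermZd_apply]
  rfl

/-- `θ_0 = Θ`: conjugating by `swap 0 0 = 1` does nothing. [folklore] -/
theorem axisRefl_zero (V : LGConfig 4 G) :
    configPermZd (Equiv.swap (0 : Fin 4) 0) (cfgReflect (configPermZd (Equiv.swap (0 : Fin 4) 0) V)) = cfgReflect V := by
  rw [Equiv.swap_self, configPermZd_refl, configPermZd_refl]

/-- The axis reflections commute: `θ_j (θ_k V) = θ_k (θ_j V)`. [folklore] -/
theorem axisRefl_comm (j k : Fin 4) (V : LGConfig 4 G) :
    configPermZd (Equiv.swap 0 j) (cfgReflect (configPermZd (Equiv.swap 0 j)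
      (configPermZd (Equiv.swap 0 k) (cfgReflect (configPermZd (Equiv.swap 0 k) V))))) =
    configPermZd (Equiv.swap 0 k) (cfgReflect (configPermZd (Equiv.swap 0 k)
      (configPermZd (Equiv.swap 0 j) (cfgReflect (configPermZd (Equiv.swap 0 j) V))))) :=
  (stub_axisReflectionsCommute G j k V).1

/-- Each axis reflection is an involution: `θ_k (θ_k V) = V`. [folklore] -/
theorem axisRefl_axisRefl (k : Fin 4) (V : LGConfig 4 G) :
    configPermZd (Equiv.swap 0 k) (cfgReflect (configPermZd (Equiv.swap 0 k)
      (configPermZd (Equiv.swap 0 k) (cfgReflect (configPermZd (Equiv.swap 0 k) V))))) = V :=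
  (stub_axisReflectionsCommute G k k V).2

/-- `Θ` commutes with every `θ_k`: `Θ (θ_k V) = θ_k (Θ V)`. [folklore] -/
theorem cfgReflect_axisRefl (k : Fin 4) (V : LGConfig 4 G) :
    cfgReflect (configPermZd (Equiv.swap 0 k) (cfgReflect (configPermZd (Equiv.swap 0 k) V))) =
      configPermZd (Equiv.swap 0 k) (cfgReflect (configPermZd (Equiv.swap 0 k) (cfgReflect V))) := by
  have h := axisRefl_comm 0 k V
  rwa [axisRefl_zero, axisRefl_zero] at h

variable [TopologicalSpace G] [IsTopologicalGroup G] [BorelSpace G]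

/-- **The `θ_k`-reflected species** `A ∘ θ_k` as a `YMSpecies`, through the landed permuted / mirror species:
`(permSpecies π (reflSpecies (permSpecies π A))).F V = A.F (θ_k V)`, `π = swap 0 k`. [folklore] -/
theorem axisReflSpecies_F (k : Fin 4) (A : YMSpecies G) (V : LGConfig 4 G) :
    (permSpecies (Equiv.swap 0 k) (reflSpecies (permSpecies (Equiv.swap 0 k) A))).F V =
      A.F (configPermZd (Equiv.swap 0 k) (cfgReflect (configPermZd (Equiv.swap 0 k) V))) := rfl

/-! ## §2 Parity bookkeeping -/

section Parity

variable (k : Fin 4) (A P M : YMSpecies G)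
  (hP : ∀ V, P.F V = A.F V + A.F (configPermZd (Equiv.swap 0 k) (cfgReflect (configPermZd (Equiv.swap 0 k) V))))
  (hM : ∀ V, M.F V = A.F V - A.F (configPermZd (Equiv.swap 0 k) (cfgReflect (configPermZd (Equiv.swap 0 k) V))))
include hP in
omit [TopologicalSpace G] [IsTopologicalGroup G] [BorelSpace G] in
/-- `P = A + A∘θ_k` is `θ_k`-even. [folklore] -/
theorem axisEven_of_sum (V : LGConfig 4 G) :
    P.F (configPermZd (Equiv.swap 0 k) (cfgReflect (configPermZd (Equiv.swap 0 k) V))) = P.F V := by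
  rw [hP, hP V, axisRefl_axisRefl, add_comm]

include hM in
omit [TopologicalSpace G] [IsTopologicalGroup G] [BorelSpace G] in
/-- `M = A − A∘θ_k` is `θ_k`-odd. [folklore] -/
theorem axisOdd_of_diff (V : LGConfig 4 G) :
    M.F (configPermZd (Equiv.swap 0 k) (cfgReflect (configPermZd (Equiv.swap 0 k) V))) = -M.F V := by
  rw [hM, hM V, axisRefl_axisRefl]
  ring

include hP hM in
omit [TopologicalSpace G] [IsTopologicalGroup G] [BorelSpace G] in
/-- `P + M = 2A`. [folklore] -/
theorem sum_eq_two_mul (V : LGConfig 4 G) : P.F V + M.F V = 2 * A.F V := by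
  rw [hP, hM]; ring

include hP in
omit [TopologicalSpace G] [IsTopologicalGroup G] [BorelSpace G] in
/-- If `A` is `Θ`-even then so is `P = A + A∘θ_k` (`Θ` and `θ_k` commute). [folklore] -/
theorem timeEven_sum (hA : ∀ V, A.F (cfgReflect V) = A.F V) (V : LGConfig 4 G) : P.F (cfgReflect V) = P.F V := by
  rw [hP, hP V, hA, ← cfgReflect_axisRefl, hA]

include hM in
omit [TopologicalSpace G] [IsTopologicalGroup G] [BorelSpace G] in
/-- If `A` is `Θ`-even then so is `M = A − A∘θ_k`. [folklore] -/
theorem timeEven_diff (hA : ∀ V, A.F (cfgReflect V) = A.F V) (V : LGConfig 4 G) : M.F (cfgReflect V) = M.F V := by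
  rw [hM, hM V, hA, ← cfgReflect_axisRefl, hA]

include hP in
omit [TopologicalSpace G] [IsTopologicalGroup G] [BorelSpace G] in
/-- If `A` is `θ_j`-even then so is `P = A + A∘θ_k` (the reflections commute). [folklore] -/
theorem axisEven_sum (j : Fin 4)
    (hA : ∀ V, A.F (configPermZd (Equiv.swap 0 j) (cfgReflect (configPermZd (Equiv.swap 0 j) V))) = A.F V)
    (V : LGConfig 4 G) :
    P.F (configPermZd (Equiv.swap 0 j) (cfgReflect (configPermZd (Equiv.swap 0 j) V))) = P.F V := by
  rw [hP, hP V, hA, ← axisRefl_comm j k, hA]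

include hM in
omit [TopologicalSpace G] [IsTopologicalGroup G] [BorelSpace G] in
/-- If `A` is `θ_j`-even then so is `M = A − A∘θ_k`. [folklore] -/
theorem axisEven_diff (j : Fin 4)
    (hA : ∀ V, A.F (configPermZd (Equiv.swap 0 j) (cfgReflect (configPermZd (Equiv.swap 0 j) V))) = A.F V)
    (V : LGConfig 4 G) :
    M.F (configPermZd (Equiv.swap 0 j) (cfgReflect (configPermZd (Equiv.swap 0 j) V))) = M.F V := by
  rw [hM, hM V, hA, ← axisRefl_comm j k, hA]

end Parity

/-! ## §3 The polarisation identity along a spatial axis reflection -/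

variable [CompactSpace G]

/-- **`4·c_A = c_P + c_M`** for `P = A + A∘θ_k`, `M = A − A∘θ_k`, `k ≠ 0`: the time-axis connected autocorrelation of a species is a
quarter of the sum of those of its `θ_k`-even and `θ_k`-odd parts — polarisation plus the selection rule (the cross terms vanish
identically). Every compact `G`, every real `β`, every torus and lag. [folklore] -/
theorem four_mul_autocorr_eq (r : LatticeRep G) (β : ℝ) {k : Fin 4} (hk : k ≠ 0) (A P M : YMSpecies G)
    (hP : ∀ V, P.F V = A.F V + A.F (configPermZd (Equiv.swap 0 k) (cfgReflect (configPermZd (Equiv.swap 0 k) V))))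
    (hM : ∀ V, M.F V = A.F V - A.F (configPermZd (Equiv.swap 0 k) (cfgReflect (configPermZd (Equiv.swap 0 k) V))))
    (S n : ℕ) :
    4 * latticeConnectedCorr r.ρ β (2 * S + 1) A.F A.F n =
      latticeConnectedCorr r.ρ β (2 * S + 1) P.F P.F n + latticeConnectedCorr r.ρ β (2 * S + 1) M.F M.F n := by
  have hsel := stub_spatialReflectionSelectionRule G r β k hk P M (axisEven_of_sum k A P hP) (axisOdd_of_diff k A M hM) S n
  rw [stub_connectedCorrPolarisation G r β A P M (sum_eq_two_mul k A P M hP hM) S n, hsel.1, hsel.2, add_zero, add_zero]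

/-- **Smallness transfers from the parts to the species**: `|c_A| ≤ (|c_P| + |c_M|)/4`. [folklore] -/
theorem abs_autocorr_le (r : LatticeRep G) (β : ℝ) {k : Fin 4} (hk : k ≠ 0) (A P M : YMSpecies G)
    (hP : ∀ V, P.F V = A.F V + A.F (configPermZd (Equiv.swap 0 k) (cfgReflect (configPermZd (Equiv.swap 0 k) V))))
    (hM : ∀ V, M.F V = A.F V - A.F (configPermZd (Equiv.swap 0 k) (cfgReflect (configPermZd (Equiv.swap 0 k) V))))
    (S n : ℕ) :
    |latticeConnectedCorr r.ρ β (2 * S + 1) A.F A.F n| ≤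
      (|latticeConnectedCorr r.ρ β (2 * S + 1) P.F P.F n| + |latticeConnectedCorr r.ρ β (2 * S + 1) M.F M.F n|) / 4 := by
  have h := four_mul_autocorr_eq r β hk A P M hP hM S n
  rw [le_div_iff₀ (by norm_num : (0 : ℝ) < 4), mul_comm, ← Nat.cast_ofNat, show ((4 : ℕ) : ℝ) = 4 by norm_num,
    show (4 : ℝ) * |latticeConnectedCorr r.ρ β (2 * S + 1) A.F A.F n| = |4 * latticeConnectedCorr r.ρ β (2 * S + 1) A.F A.F n| by
      rw [abs_mul, abs_of_pos (by norm_num : (0 : ℝ) < 4)], h]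
  exact abs_add_le _ _

/-! ## §4 The no-long-range-order clause passes from the parts to the species -/

/-- **Clause transfer**: if the `θ_k`-even part `P` and the `θ_k`-odd part `M` of `A` (`k ≠ 0`) have no long-range order along the time
axis, uniformly in the odd tori, then neither has `A`. [folklore] -/
theorem clause_of_parts (r : LatticeRep G) (β : ℝ) {k : Fin 4} (hk : k ≠ 0) (A P M : YMSpecies G)
    (hP : ∀ V, P.F V = A.F V + A.F (configPermZd (Equiv.swap 0 k) (cfgReflect (configPermZd (Equiv.swap 0 k) V))))
    (hM : ∀ V, M.F V = A.F V - A.F (configPermZd (Equiv.swap 0 k) (cfgReflect (configPermZd (Equiv.swap 0 k) V))))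
    (hcP : ∀ ε : ℝ, 0 < ε → ∃ j₀ : ℕ, ∀ S j : ℕ, j₀ ≤ j → j ≤ S → |latticeConnectedCorr r.ρ β (2 * S + 1) P.F P.F j| ≤ ε)
    (hcM : ∀ ε : ℝ, 0 < ε → ∃ j₀ : ℕ, ∀ S j : ℕ, j₀ ≤ j → j ≤ S → |latticeConnectedCorr r.ρ β (2 * S + 1) M.F M.F j| ≤ ε)
    {ε : ℝ} (hε : 0 < ε) :
    ∃ j₀ : ℕ, ∀ S j : ℕ, j₀ ≤ j → j ≤ S → |latticeConnectedCorr r.ρ β (2 * S + 1) A.F A.F j| ≤ ε := by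
  obtain ⟨j₁, hj₁⟩ := hcP ε hε
  obtain ⟨j₂, hj₂⟩ := hcM ε hε
  refine ⟨max j₁ j₂, fun S j hj hjS => ?_⟩
  have h1 := hj₁ S j ((le_max_left _ _).trans hj) hjS
  have h2 := hj₂ S j ((le_max_right _ _).trans hj) hjS
  have h := abs_autocorr_le r β hk A P M hP hM S j
  linarith

/-! ## §5 At fixed `(G, r, β)`: the even clause ⟺ the axis-even clause ∧ the direction transfer -/

/-- **At fixed `(G, r, β)`** (every compact `G`, every real `β`): "no `Θ`-even species has long-range order along the time axis,
uniformly in the odd tori" is EQUIVALENT to the conjunction of the same clause for the species even under all four axis reflections and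
for the `Θ`-even species odd under some spatial reflection `θ_k`. `→` is restriction; `←` decomposes a `Θ`-even `A` three times,
`64·c_A = c_{P₁₂₃} + c_{M₁₂₃} + 4c_{M₁₂} + 16c_{M₁}`, each piece `Θ`-even (§2), the `P`-piece even under `θ₁, θ₂, θ₃`. [folklore] -/
theorem evenClause_iff_axisParity (r : LatticeRep G) (β : ℝ) :
    (∀ A : YMSpecies G, (∀ V, A.F (cfgReflect V) = A.F V) → ∀ ε : ℝ, 0 < ε → ∃ j₀ : ℕ, ∀ S j : ℕ, j₀ ≤ j → j ≤ S →
        |latticeConnectedCorr r.ρ β (2 * S + 1) A.F A.F j| ≤ ε) ↔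
    ((∀ A : YMSpecies G, (∀ V, A.F (cfgReflect V) = A.F V) →
        (∀ k : Fin 4, k ≠ 0 → ∀ V, A.F (configPermZd (Equiv.swap 0 k) (cfgReflect (configPermZd (Equiv.swap 0 k) V))) = A.F V) →
        ∀ ε : ℝ, 0 < ε → ∃ j₀ : ℕ, ∀ S j : ℕ, j₀ ≤ j → j ≤ S → |latticeConnectedCorr r.ρ β (2 * S + 1) A.F A.F j| ≤ ε) ∧
     (∀ k : Fin 4, k ≠ 0 → ∀ A : YMSpecies G, (∀ V, A.F (cfgReflect V) = A.F V) →
        (∀ V, A.F (configPermZd (Equiv.swap 0 k) (cfgReflect (configPermZd (Equiv.swap 0 k) V))) = -A.F V) →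
        ∀ ε : ℝ, 0 < ε → ∃ j₀ : ℕ, ∀ S j : ℕ, j₀ ≤ j → j ≤ S → |latticeConnectedCorr r.ρ β (2 * S + 1) A.F A.F j| ≤ ε)) := by
  constructor
  · intro h
    exact ⟨fun A hA _ => h A hA, fun k _ A hA _ => h A hA⟩
  · rintro ⟨h₁, h₂⟩ A hA ε hε
    -- abbreviations for the even / odd parts along `θ_k`
    let sym : Fin 4 → YMSpecies G → YMSpecies G := fun k X =>
      addSpecies X (permSpecies (Equiv.swap 0 k) (reflSpecies (permSpecies (Equiv.swap 0 k) X)))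
    let anti : Fin 4 → YMSpecies G → YMSpecies G := fun k X =>
      subSpecies X (permSpecies (Equiv.swap 0 k) (reflSpecies (permSpecies (Equiv.swap 0 k) X)))
    have hsym : ∀ (k : Fin 4) (X : YMSpecies G) (V : LGConfig 4 G), (sym k X).F V =
        X.F V + X.F (configPermZd (Equiv.swap 0 k) (cfgReflect (configPermZd (Equiv.swap 0 k) V))) := fun k X V => rfl
    have hanti : ∀ (k : Fin 4) (X : YMSpecies G) (V : LGConfig 4 G), (anti k X).F V =
        X.F V - X.F (configPermZd (Equiv.swap 0 k) (cfgReflect (configPermZd (Equiv.swap 0 k) V))) := fun k X V => rfl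
    have h1 : (1 : Fin 4) ≠ 0 := by decide
    have h2 : (2 : Fin 4) ≠ 0 := by decide
    have h3 : (3 : Fin 4) ≠ 0 := by decide
    -- first cut along `θ₁`
    set P₁ := sym 1 A with hP₁
    set M₁ := anti 1 A with hM₁
    have hP₁t : ∀ V, P₁.F (cfgReflect V) = P₁.F V := timeEven_sum 1 A P₁ (hsym 1 A) hA
    have hM₁t : ∀ V, M₁.F (cfgReflect V) = M₁.F V := timeEven_diff 1 A M₁ (hanti 1 A) hA
    have hP₁e1 := axisEven_of_sum 1 A P₁ (hsym 1 A)
    have hM₁o : ∀ V, M₁.F (configPermZd (Equiv.swap 0 1) (cfgReflect (configPermZd (Equiv.swap 0 1) V))) = -M₁.F V :=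
      axisOdd_of_diff 1 A M₁ (hanti 1 A)
    -- second cut along `θ₂`
    set P₂ := sym 2 P₁ with hP₂
    set M₂ := anti 2 P₁ with hM₂
    have hP₂t : ∀ V, P₂.F (cfgReflect V) = P₂.F V := timeEven_sum 2 P₁ P₂ (hsym 2 P₁) hP₁t
    have hM₂t : ∀ V, M₂.F (cfgReflect V) = M₂.F V := timeEven_diff 2 P₁ M₂ (hanti 2 P₁) hP₁t
    have hP₂e1 := axisEven_sum 2 P₁ P₂ (hsym 2 P₁) 1 hP₁e1
    have hP₂e2 := axisEven_of_sum 2 P₁ P₂ (hsym 2 P₁)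
    have hM₂o : ∀ V, M₂.F (configPermZd (Equiv.swap 0 2) (cfgReflect (configPermZd (Equiv.swap 0 2) V))) = -M₂.F V :=
      axisOdd_of_diff 2 P₁ M₂ (hanti 2 P₁)
    -- third cut along `θ₃`
    set P₃ := sym 3 P₂ with hP₃
    set M₃ := anti 3 P₂ with hM₃
    have hP₃t : ∀ V, P₃.F (cfgReflect V) = P₃.F V := timeEven_sum 3 P₂ P₃ (hsym 3 P₂) hP₂t
    have hM₃t : ∀ V, M₃.F (cfgReflect V) = M₃.F V := timeEven_diff 3 P₂ M₃ (hanti 3 P₂) hP₂t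
    have hP₃e1 := axisEven_sum 3 P₂ P₃ (hsym 3 P₂) 1 hP₂e1
    have hP₃e2 := axisEven_sum 3 P₂ P₃ (hsym 3 P₂) 2 hP₂e2
    have hP₃e3 := axisEven_of_sum 3 P₂ P₃ (hsym 3 P₂)
    have hM₃o : ∀ V, M₃.F (configPermZd (Equiv.swap 0 3) (cfgReflect (configPermZd (Equiv.swap 0 3) V))) = -M₃.F V :=
      axisOdd_of_diff 3 P₂ M₃ (hanti 3 P₂)
    -- the fully even piece
    have hP₃all : ∀ k : Fin 4, k ≠ 0 → ∀ V,
        P₃.F (configPermZd (Equiv.swap 0 k) (cfgReflect (configPermZd (Equiv.swap 0 k) V))) = P₃.F V := by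
      intro k hk V
      fin_cases k
      · exact absurd rfl hk
      · exact hP₃e1 V
      · exact hP₃e2 V
      · exact hP₃e3 V
    have cP₃ := h₁ P₃ hP₃t hP₃all
    have cM₃ := h₂ 3 h3 M₃ hM₃t hM₃o
    have cP₂ : ∀ ε : ℝ, 0 < ε → ∃ j₀ : ℕ, ∀ S j : ℕ, j₀ ≤ j → j ≤ S →
        |latticeConnectedCorr r.ρ β (2 * S + 1) P₂.F P₂.F j| ≤ ε :=
      fun δ hδ => clause_of_parts r β h3 P₂ P₃ M₃ (hsym 3 P₂) (hanti 3 P₂) cP₃ cM₃ hδ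
    have cM₂ := h₂ 2 h2 M₂ hM₂t hM₂o
    have cP₁ : ∀ ε : ℝ, 0 < ε → ∃ j₀ : ℕ, ∀ S j : ℕ, j₀ ≤ j → j ≤ S →
        |latticeConnectedCorr r.ρ β (2 * S + 1) P₁.F P₁.F j| ≤ ε :=
      fun δ hδ => clause_of_parts r β h2 P₁ P₂ M₂ (hsym 2 P₁) (hanti 2 P₁) cP₂ cM₂ hδ
    have cM₁ := h₂ 1 h1 M₁ hM₁t hM₁o
    exact clause_of_parts r β h1 A P₁ M₁ (hsym 1 A) (hanti 1 A) cP₁ cM₁ hε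

/-! ## §6 The weak-coupling statements -/

/-- **`NoEvenLongRangeOrder ⟺ NoAxisEvenLRO ∧ EvenOddDirectionTransfer`** (the crux-strategist's §D5 cut of the purity child
stmt-QuantumFields-18060, kernel-checked): at weak coupling, "no `Θ`-even gauge-invariant local observable has long-range order along the
time axis, uniformly in the odd tori" holds for every compact simple `G` and every `r` iff it holds (i) for the observables even under ALL
FOUR axis reflections and (ii) for the `Θ`-even observables odd under some spatial axis reflection `θ_k` — the latter being the statement
that long-range order is direction-blind (such an observable has `β`-uniformly summable autocorrelation along its own axis `e_k`,
`stub_axisOddSpeciesSummable`). `β₀ ↦ max β₀⁽ⁱ⁾ β₀⁽ⁱⁱ⁾` in the direction `←`. [folklore] -/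
theorem noEvenLRO_iff_axisParity :
    (∀ (G : Type) [Group G] [TopologicalSpace G] [IsTopologicalGroup G] [CompactSpace G] [MeasurableSpace G] [BorelSpace G],
      IsCompactSimpleLieGroup G → ∀ r : LatticeRep G, ∃ β₀ : ℝ, ∀ β : ℝ, β₀ ≤ β →
      ∀ A : YMSpecies G, (∀ V, A.F (cfgReflect V) = A.F V) → ∀ ε : ℝ, 0 < ε → ∃ j₀ : ℕ, ∀ S j : ℕ,
        j₀ ≤ j → j ≤ S → |latticeConnectedCorr r.ρ β (2 * S + 1) A.F A.F j| ≤ ε) ↔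
    ((∀ (G : Type) [Group G] [TopologicalSpace G] [IsTopologicalGroup G] [CompactSpace G] [MeasurableSpace G] [BorelSpace G],
      IsCompactSimpleLieGroup G → ∀ r : LatticeRep G, ∃ β₀ : ℝ, ∀ β : ℝ, β₀ ≤ β →
      ∀ A : YMSpecies G, (∀ V, A.F (cfgReflect V) = A.F V) →
        (∀ k : Fin 4, k ≠ 0 → ∀ V, A.F (configPermZd (Equiv.swap 0 k) (cfgReflect (configPermZd (Equiv.swap 0 k) V))) = A.F V) →
        ∀ ε : ℝ, 0 < ε → ∃ j₀ : ℕ, ∀ S j : ℕ, j₀ ≤ j → j ≤ S → |latticeConnectedCorr r.ρ β (2 * S + 1) A.F A.F j| ≤ ε) ∧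
     (∀ (G : Type) [Group G] [TopologicalSpace G] [IsTopologicalGroup G] [CompactSpace G] [MeasurableSpace G] [BorelSpace G],
      IsCompactSimpleLieGroup G → ∀ r : LatticeRep G, ∃ β₀ : ℝ, ∀ β : ℝ, β₀ ≤ β →
      ∀ k : Fin 4, k ≠ 0 → ∀ A : YMSpecies G, (∀ V, A.F (cfgReflect V) = A.F V) →
        (∀ V, A.F (configPermZd (Equiv.swap 0 k) (cfgReflect (configPermZd (Equiv.swap 0 k) V))) = -A.F V) →
        ∀ ε : ℝ, 0 < ε → ∃ j₀ : ℕ, ∀ S j : ℕ, j₀ ≤ j → j ≤ S → |latticeConnectedCorr r.ρ β (2 * S + 1) A.F A.F j| ≤ ε)) := by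
  constructor
  · intro h
    refine ⟨fun G _ _ _ _ _ _ hG r => ?_, fun G _ _ _ _ _ _ hG r => ?_⟩
    · obtain ⟨β₀, hβ₀⟩ := h G hG r
      exact ⟨β₀, fun β hβ => ((evenClause_iff_axisParity r β).1 (hβ₀ β hβ)).1⟩
    · obtain ⟨β₀, hβ₀⟩ := h G hG r
      exact ⟨β₀, fun β hβ => ((evenClause_iff_axisParity r β).1 (hβ₀ β hβ)).2⟩
  · rintro ⟨h₁, h₂⟩ G _ _ _ _ _ _ hG r
    obtain ⟨β₁, hβ₁⟩ := h₁ G hG r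
    obtain ⟨β₂, hβ₂⟩ := h₂ G hG r
    refine ⟨max β₁ β₂, fun β hβ => ?_⟩
    exact (evenClause_iff_axisParity r β).2 ⟨hβ₁ β ((le_max_left _ _).trans hβ), hβ₂ β ((le_max_right _ _).trans hβ)⟩

/-! ## §7 The direction-transfer species decorrelate along their own axis (spatial lattice Vafa–Witten) -/

/-- **The P2 species are `β`-uniformly `ℓ¹` along their own axis**: a `θ_k`-odd gauge-invariant local observable (`k` arbitrary; for the
direction-transfer conjunct `k ≠ 0` and the observable is moreover `Θ`-even) has `Σ_{n<2S+1} |Cov_{β,S}(A∘lift, A∘τ_{n e_k}∘lift)| ≤ C(A)` for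
all `β ≥ 0` and all odd tori — pointer to the landed `stub_axisOddSpeciesSummable`; what P2 adds is decorrelation along the TIME axis. [folklore] -/
theorem transferSpecies_summable_along_own_axis (r : LatticeRep G) (k : Fin 4) (A : YMSpecies G)
    (hodd : ∀ V, A.F (configPermZd (Equiv.swap 0 k) (cfgReflect (configPermZd (Equiv.swap 0 k) V))) = -A.F V) :
    ∃ C : ℝ, ∀ β : ℝ, 0 ≤ β → ∀ S : ℕ, ∑ n ∈ Finset.range (2 * S + 1),
      |cov[fun U => A.F (torusLift (2 * S + 1) U), fun U => A.F (configShift (-(Pi.single k (n : ℤ))) (torusLift (2 * S + 1) U));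
        wilsonMeasure (d := 4) (L := 2 * S + 1) r.ρ β]| ≤ C :=
  stub_axisOddSpeciesSummable G r k A hodd

end AxisParity

/-- **Registered sub-goal `stub_noEvenLRO_iff_axisParity`** of item stmt-QuantumFields-9442 (signature verbatim, fully qualified): the purity
child `NoEvenLongRangeOrder` (item stmt-QuantumFields-18060) is EQUIVALENT to "no long-range order along the time axis for the species even under
all four axis reflections" ∧ "no long-range order along the time axis for the `Θ`-even species odd under some spatial axis reflection"
(`AxisParity.noEvenLRO_iff_axisParity`). [folklore] -/
theorem stub_noEvenLRO_iff_axisParity : (∀ (G : Type) [Group G] [TopologicalSpace G] [IsTopologicalGroup G] [CompactSpace G] [MeasurableSpace G] [BorelSpace G], Literature.MathematicalPhysics.QuantumFieldTheory.IsCompactSimpleLieGroup G → ∀ r : Literature.MathematicalPhysics.QuantumFieldTheory.LatticeRep G, ∃ β₀ : ℝ, ∀ β : ℝ, β₀ ≤ β → ∀ A : Literature.MathematicalPhysics.QuantumFieldTheory.YMSpecies G, (∀ V, A.F (Literature.MathematicalPhysics.QuantumFieldTheory.cfgReflect V) = A.F V) → ∀ ε : ℝ, 0 < ε → ∃ j₀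 : ℕ, ∀ S j : ℕ, j₀ ≤ j → j ≤ S → |Literature.MathematicalPhysics.QuantumFieldTheory.latticeConnectedCorr r.ρ β (2 * S + 1) A.F A.F j| ≤ ε) ↔ ((∀ (G : Type) [Group G] [TopologicalSpace G] [IsTopologicalGroup G] [CompactSpace G] [MeasurableSpace G] [BorelSpace G], Literature.MathematicalPhysics.QuantumFieldTheory.IsCompactSimpleLieGroup G → ∀ r : Literature.MathematicalPhysics.QuantumFieldTheory.LatticeRep G, ∃ β₀ : ℝ, ∀ β : ℝ, β₀ ≤ β → ∀ A : Literature.MathematicalPhysics.QuantumFieldTheory.YMSpecies G, (∀ V, A.F (Literature.MathematicalPhysics.QuantumFieldTheory.cfgReflect V) = A.F V) → (∀ k : Fin 4, k ≠ 0 → ∀ V, A.F (Literature.MathematicalPhysics.QuantumFieldTheory.configPermZd (Equiv.swap 0 k) (Literature.MathematicalPhysics.QuantumFieldTheory.cfgReflect (Literature.MathematicalPhysics.QuantumFieldTheory.configPermZd (Equiv.swap 0 k) V))) = A.F V) → ∀ ε : ℝ, 0 < ε → ∃ j₀ : ℕ, ∀ S j : ℕ, j₀ ≤ j → j ≤ S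 → |Literature.MathematicalPhysics.QuantumFieldTheory.latticeConnectedCorr r.ρ β (2 * S + 1) A.F A.F j| ≤ ε) ∧ (∀ (G : Type) [Group G] [TopologicalSpace G] [IsTopologicalGroup G] [CompactSpace G] [MeasurableSpace G] [BorelSpace G], Literature.MathematicalPhysics.QuantumFieldTheory.IsCompactSimpleLieGroup G → ∀ r : Literature.MathematicalPhysics.QuantumFieldTheory.LatticeRep G, ∃ β₀ : ℝ, ∀ β : ℝ, β₀ ≤ β → ∀ (k : Fin 4), k ≠ 0 → ∀ A : Literature.MathematicalPhysics.QuantumFieldTheory.YMSpecies G, (∀ V, A.F (Literature.MathematicalPhysics.QuantumFieldTheory.cfgReflect V) = A.F V) → (∀ V, A.F (Literature.MathematicalPhysics.QuantumFieldTheory.configPermZd (Equiv.swap 0 k) (Literature.MathematicalPhysics.QuantumFieldTheory.cfgReflect (Literature.MathematicalPhysics.QuantumFieldTheory.configPermZd (Equiv.swap 0 k) V))) = -A.F V) → ∀ ε : ℝ, 0 < ε → ∃ j₀ : ℕ, ∀ S j : ℕ, j₀ ≤ j → j ≤ S → |Literature.MathematicalPhysics.QuantumFieldTheory.latticeConnectedCorr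 r.ρ β (2 * S + 1) A.F A.F j| ≤ ε)) :=
  AxisParity.noEvenLRO_iff_axisParity

end Summit.QuantumFields.YangMills.Theorems.FiniteSusceptibilityWeakCoupling

end
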